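import Summits.QuantumAdvantage.QuantumAdvantage.Theorems.CubicForrelationSignedExactCubicForrelationNotPrBPPStubNoTrapTemplateLemmas

/-!
# No-trap theorem (template coordinates) — helper lemmas, part 2: closed pairs and frames

Helper file for stub `stub_noTrapTemplate` of line `dual-pingpong-frame`, crux stmt-QuantumAdvantage-13932
(`SignedExactCubicForrelationNotPrBPP`, route `QuantumAdvantage/CubicForrelation`). No definitions (the second
difference `D_u D_v f` is a parameter `D` with its defining equation `hD`, as in part 1).

* `flat_of_closed_orth` (closed + orthogonal ⇒ flat): if every slice row `k ↦ D_{e_k} D_s D_y f (0)` (`s ∈ A`)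
  lies in `B`, the offset `r ↦ D_s D_r f (0)` on `rad B_s` is represented by some `ℓ ∈ B`, and `A ⊥ B`, then
  all second differences `D_s D_{s₂} f`, `s, s₂ ∈ A`, vanish identically (`f` of degree `≤ 3`).
* The ABSTRACT FRAME of a Maiorana–McFarland template: a map `F : 𝔽₂^m → 𝔽₂ⁿ` (frame directions), an
  additive `p : 𝔽₂ⁿ → 𝔽₂^m` (permuted coordinates) and a coordinatewise-quadratic `π` with the frame law
  `f X ⊕ f (X ⊕ F g) = g·π(p X)` (both `b(y',y'') = y'·π(y'') ⊕ h(y'')` with `F g = (g,0)`, `p = proj''` and the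
  dual shape `a(x',x'') = x''·σ(x') ⊕ …` with `F r = (0,r)`, `p = proj'` are instances). Then
  `D_s D_{F g} f (X) = g·π(pX) ⊕ g·π(pX ⊕ ps)` (`frame_D2`), `D_{F g} D_s D_y f = g·B_π(ps, py)` (`frame_D3`);
  so the rows of a closed pair project onto `Im B_π(ps, ·)` (`frame_row_mem`) and — testing the offset on the
  frame directions `F g`, `g ⊥ Im B_π(ps,·)`, and using `W^⊥⊥ = W` — the vector `π(ps) ⊕ π(0)` lies in the
  projection of `B` as well (`frame_offset_mem`).

References: C. Carlet, *Boolean Functions for Cryptography and Coding Theory*, CUP 2020, Prop. 54, §5.2 [Carlet2020];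
R. O'Donnell, *Analysis of Boolean Functions*, CUP 2014, §3.3 [ODonnell2014].
-/

noncomputable section

set_option linter.dupNamespace false -- D-0017: single-problem summit ⇒ `QuantumAdvantage.QuantumAdvantage` by design

namespace Summit.QuantumAdvantage.QuantumAdvantage.Theorems.SignedExactCubicForrelationNotPrBPP

open Finset
open Literature.Computability.Complexity Literature.Computability.QuantumComplexity
open Literature.Computability.QuantumComplexity.BuzetChailloux (bxor zeroVec bxor_self bxor_comm
  bxor_zeroVec zeroVec_bxor bxor_bxor_cancel_left)
open Literature.Computability.Complexity.BLR (toZ toZ_xor toZ_and toZ_injective)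
open PolarGeometry (toZ_bdot bdot_comm bdot_bxor_left bdot_bxor_right twist_eq_one_iff_bdot bdot_bracket
  bv_bxor bv_zero_right bxor_bxor_swap bxor_bxor_assoc)

namespace NoTrap

variable {m n : ℕ}

/-! ### Inner products against pointwise xors -/

/-- `g·(a ⊕ b) = g·a ⊕ g·b` (pointwise spelling of `bdot_bxor_right`). [folklore] -/
theorem bdot_xor_right (g a b : Fin m → Bool) :
    (univ.filter fun i => g i && (a i ^^ b i)).card.bodd =
      ((univ.filter fun i => g i && a i).card.bodd ^^ (univ.filter fun i => g i && b i).card.bodd) :=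
  bdot_bxor_right g a b

/-- `g·(a ⊕ b ⊕ c ⊕ d) = g·a ⊕ g·b ⊕ g·c ⊕ g·d`. [folklore] -/
theorem bdot_xor4_right (g a b c d : Fin m → Bool) :
    (univ.filter fun i => g i && (a i ^^ b i ^^ c i ^^ d i)).card.bodd =
      ((univ.filter fun i => g i && a i).card.bodd ^^ (univ.filter fun i => g i && b i).card.bodd ^^
        (univ.filter fun i => g i && c i).card.bodd ^^ (univ.filter fun i => g i && d i).card.bodd) := by
  rw [← bdot_xor_right, ← bdot_xor_right, ← bdot_xor_right]

/-! ### Closed + orthogonal ⇒ flat -/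

/-- **Closed orthogonal pairs are flat.** For `f` of degree `≤ 3`: if the slice rows
`k ↦ D_{e_k} D_s D_y f (0)` (`s ∈ A`, all `y`) lie in `B`, the offset `r ↦ D_s D_r f (0)` restricted to
`rad B_s = {r : D_s D_r f constant}` is represented by some `ℓ ∈ B`, and `A ⊥ B`, then `D_s D_{s₂} f ≡ 0` for
all `s, s₂ ∈ A` (`D_{s₂} D_s D_y f (0) = row·s₂ = 0` puts `s₂` in `rad B_s`, and then
`D_s D_{s₂} f (0) = ℓ·s₂ = 0`). [cite: Carlet2020, §2.2.2] -/
theorem flat_of_closed_orth {f : (Fin n → Bool) → Bool} (hf : IsDegLeFun 3 f)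
    (D : (Fin n → Bool) → (Fin n → Bool) → (Fin n → Bool) → Bool)
    (hD : ∀ u v x, D u v x = (f x ^^ f (bxor x u) ^^ f (bxor x v) ^^ f (bxor x (bxor u v))))
    {A B : Finset (Fin n → Bool)}
    (hrow : ∀ s ∈ A, ∀ y, (fun k => (D s y zeroVec ^^ D s y (fun j => decide (j = k)))) ∈ B)
    (hoff : ∀ s ∈ A, ∃ ℓ ∈ B, ∀ r, (∀ y z, (D s r z ^^ D s r (bxor z y)) = false) →
      (f r ^^ f (bxor r s) ^^ f zeroVec ^^ f s) = (univ.filter fun i => ℓ i && r i).card.bodd)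
    (horth : ∀ s ∈ A, ∀ u ∈ B, (univ.filter fun i => s i && u i).card.bodd = false) :
    ∀ s ∈ A, ∀ s₂ ∈ A, ∀ x, D s s₂ x = false := by
  intro s hs s₂ hs₂
  have h3 : ∀ y, (D s y zeroVec ^^ D s y s₂) = false := fun y => by
    rw [D3_repr hf D hD s y s₂, bdot_comm]
    exact horth s₂ hs₂ _ (hrow s hs y)
  have hrad : ∀ y z, (D s s₂ z ^^ D s s₂ (bxor z y)) = false := fun y z => by
    rw [D3_basefree hf D hD s s₂ y z, D3_swap D hD s s₂ y]
    exact h3 y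
  obtain ⟨ℓ, hℓB, hℓ⟩ := hoff s hs
  have h0 : D s s₂ zeroVec = false := by
    rw [D_zeroVec_eq D hD s s₂, hℓ s₂ hrad, bdot_comm]
    exact horth s₂ hs₂ ℓ hℓB
  intro x
  have key := hrad x zeroVec
  rw [zeroVec_bxor, h0, Bool.false_xor] at key
  exact key

/-! ### The abstract frame of a Maiorana–McFarland template -/

/-- **Frame second difference**: under the frame law `f X ⊕ f (X ⊕ F g) = g·π(pX)` with additive `p`,
`D_s D_{F g} f (X) = g·π(pX) ⊕ g·π(pX ⊕ ps)`. [cite: Carlet2020, Prop. 54] -/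
theorem frame_D2 {f : (Fin n → Bool) → Bool} {F : (Fin m → Bool) → (Fin n → Bool)}
    {p : (Fin n → Bool) → (Fin m → Bool)} {π : (Fin m → Bool) → (Fin m → Bool)}
    (D : (Fin n → Bool) → (Fin n → Bool) → (Fin n → Bool) → Bool)
    (hD : ∀ u v x, D u v x = (f x ^^ f (bxor x u) ^^ f (bxor x v) ^^ f (bxor x (bxor u v))))
    (hF : ∀ X g, (f X ^^ f (bxor X (F g))) = (univ.filter fun i => g i && π (p X) i).card.bodd)
    (hp : ∀ X Y, p (bxor X Y) = bxor (p X) (p Y)) (s X : Fin n → Bool) (g : Fin m → Bool) :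
    D s (F g) X = ((univ.filter fun i => g i && π (p X) i).card.bodd ^^
      (univ.filter fun i => g i && π (bxor (p X) (p s)) i).card.bodd) := by
  have h1 := hF X g
  have h2 := hF (bxor X s) g
  rw [hp] at h2
  have e : f (bxor X (bxor s (F g))) = f (bxor (bxor X s) (F g)) := by rw [bxor_bxor_assoc]
  rw [hD, e, ← h1, ← h2]
  generalize f X = A; generalize f (bxor X s) = B; generalize f (bxor X (F g)) = C
  generalize f (bxor (bxor X s) (F g)) = E
  revert A B C E; decide

/-- Regrouping two second differences columnwise. [folklore] -/
theorem xor_cols (a b c d a' b' c' d' : Bool) :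
    ((a ^^ b ^^ c ^^ d) ^^ (a' ^^ b' ^^ c' ^^ d')) = (((a ^^ a') ^^ (b ^^ b')) ^^ ((c ^^ c') ^^ (d ^^ d'))) := by
  revert a b c d a' b' c' d'; decide

/-- **Frame third difference**: `D_{F g} D_s D_y f (X) = g·B_π(ps, py)` with the polar form
`B_π(v, w) = π(v ⊕ w) ⊕ π(v) ⊕ π(w) ⊕ π(0)` of the coordinatewise-quadratic `π`. [cite: Carlet2020, §5.2] -/
theorem frame_D3 {f : (Fin n → Bool) → Bool} {F : (Fin m → Bool) → (Fin n → Bool)}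
    {p : (Fin n → Bool) → (Fin m → Bool)} {π : (Fin m → Bool) → (Fin m → Bool)}
    (D : (Fin n → Bool) → (Fin n → Bool) → (Fin n → Bool) → Bool)
    (hD : ∀ u v x, D u v x = (f x ^^ f (bxor x u) ^^ f (bxor x v) ^^ f (bxor x (bxor u v))))
    (hπ : ∀ i, IsDegLeFun 2 fun y => π y i)
    (hF : ∀ X g, (f X ^^ f (bxor X (F g))) = (univ.filter fun i => g i && π (p X) i).card.bodd)
    (hp : ∀ X Y, p (bxor X Y) = bxor (p X) (p Y)) (s y X : Fin n → Bool) (g : Fin m → Bool) :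
    (D s y X ^^ D s y (bxor X (F g))) =
      (univ.filter fun i => g i &&
        (π (bxor (p s) (p y)) i ^^ π (p s) i ^^ π (p y) i ^^ π zeroVec i)).card.bodd := by
  have h1 := hF X g
  have h2 := hF (bxor X s) g
  have h3 := hF (bxor X y) g
  have h4 := hF (bxor X (bxor s y)) g
  rw [hp] at h2 h3 h4
  rw [hp, bxor_bxor_swap (p X) (p s) (p y)] at h4
  have e2 : f (bxor (bxor X (F g)) s) = f (bxor (bxor X s) (F g)) :=
    congrArg f (by show (X + F g) + s = (X + s) + F g; abel)
  have e3 : f (bxor (bxor X (F g)) y) = f (bxor (bxor X y) (F g)) :=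
    congrArg f (by show (X + F g) + y = (X + y) + F g; abel)
  have e4 : f (bxor (bxor X (F g)) (bxor s y)) = f (bxor (bxor X (bxor s y)) (F g)) :=
    congrArg f (by show (X + F g) + (s + y) = (X + (s + y)) + F g; abel)
  rw [hD, hD, e2, e3, e4, xor_cols, h1, h2, h3, h4]
  exact bdot_bracket hπ g (p X) (p s) (p y)

/-- **Frame directions orthogonal to `Im B_π(ps, ·)` lie in `rad B_s`**: if `g·B_π(ps, t) = 0` for all `t`
then `D_s D_{F g} f` is constant. [cite: Carlet2020, §5.2] -/
theorem frame_inRad {f : (Fin n → Bool) → Bool} {F : (Fin m → Bool) → (Fin n → Bool)}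
    {p : (Fin n → Bool) → (Fin m → Bool)} {π : (Fin m → Bool) → (Fin m → Bool)}
    (D : (Fin n → Bool) → (Fin n → Bool) → (Fin n → Bool) → Bool)
    (hD : ∀ u v x, D u v x = (f x ^^ f (bxor x u) ^^ f (bxor x v) ^^ f (bxor x (bxor u v))))
    (hπ : ∀ i, IsDegLeFun 2 fun y => π y i)
    (hF : ∀ X g, (f X ^^ f (bxor X (F g))) = (univ.filter fun i => g i && π (p X) i).card.bodd)
    (hp : ∀ X Y, p (bxor X Y) = bxor (p X) (p Y)) (s : Fin n → Bool) (g : Fin m → Bool)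
    (hg : ∀ t, (univ.filter fun i => g i &&
      (π (bxor (p s) t) i ^^ π (p s) i ^^ π t i ^^ π zeroVec i)).card.bodd = false) :
    ∀ y z, (D s (F g) z ^^ D s (F g) (bxor z y)) = false := by
  intro y z
  rw [frame_D2 D hD hF hp s z g, frame_D2 D hD hF hp s (bxor z y) g, hp z y,
    bdot_bracket hπ g (p z) (p s) (p y)]
  exact hg (p y)

/-- **Rows project onto `Im B_π(ps, ·)`**: if the frame directions of the unit vectors are unit vectors
(`F eᵢ = e_{κ i}`) and the rows `k ↦ D_{e_k} D_s D_y f (0)` (`s ∈ A`) lie in `B`, then every `B_π(ps, t)` lies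
in the projection `{(u_{κ i})ᵢ : u ∈ B}`. [cite: Carlet2020, Prop. 54] -/
theorem frame_row_mem {f : (Fin n → Bool) → Bool} {F : (Fin m → Bool) → (Fin n → Bool)}
    {p : (Fin n → Bool) → (Fin m → Bool)} {π : (Fin m → Bool) → (Fin m → Bool)} {κ : Fin m → Fin n}
    (D : (Fin n → Bool) → (Fin n → Bool) → (Fin n → Bool) → Bool)
    (hD : ∀ u v x, D u v x = (f x ^^ f (bxor x u) ^^ f (bxor x v) ^^ f (bxor x (bxor u v))))
    (hπ : ∀ i, IsDegLeFun 2 fun y => π y i)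
    (hF : ∀ X g, (f X ^^ f (bxor X (F g))) = (univ.filter fun i => g i && π (p X) i).card.bodd)
    (hp : ∀ X Y, p (bxor X Y) = bxor (p X) (p Y)) (hsurj : ∀ t, ∃ X, p X = t)
    (hunit : ∀ i, F (fun j => decide (j = i)) = fun j => decide (j = κ i))
    {A B : Finset (Fin n → Bool)}
    (hrow : ∀ s ∈ A, ∀ y, (fun k => (D s y zeroVec ^^ D s y (fun j => decide (j = k)))) ∈ B) :
    ∀ s ∈ A, ∀ t, (fun i => (π (bxor (p s) t) i ^^ π (p s) i ^^ π t i ^^ π zeroVec i)) ∈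
      B.image (fun u i => u (κ i)) := by
  intro s hs t
  obtain ⟨Y, rfl⟩ := hsurj t
  refine mem_image.2 ⟨_, hrow s hs Y, ?_⟩
  funext i
  show (D s Y zeroVec ^^ D s Y (fun j => decide (j = κ i))) = _
  rw [← hunit i, ← zeroVec_bxor (F _), frame_D3 D hD hπ hF hp s Y zeroVec, bdot_unit]

/-- The projection `{(u_{κ i})ᵢ : u ∈ B}` of a `⊕`-closed `B` is `⊕`-closed. [folklore] -/
theorem bxor_mem_image_proj {κ : Fin m → Fin n} {B : Finset (Fin n → Bool)}
    (hBadd : ∀ x ∈ B, ∀ y ∈ B, bxor x y ∈ B) :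
    ∀ x ∈ B.image (fun u i => u (κ i)), ∀ y ∈ B.image (fun u i => u (κ i)),
      bxor x y ∈ B.image (fun u i => u (κ i)) := by
  intro x hx y hy
  obtain ⟨u, hu, rfl⟩ := mem_image.1 hx
  obtain ⟨v, hv, rfl⟩ := mem_image.1 hy
  exact mem_image.2 ⟨bxor u v, hBadd u hu v hv, rfl⟩

/-- **The offset projects onto `π(ps) ⊕ π(0) + Im B_π(ps, ·)`**: in the abstract frame
(`f X ⊕ f (X ⊕ F g) = g·π(pX)`, `p` additive, `(F g)·u = g·(u_{κ i})ᵢ`, `F eᵢ = e_{κ i}`), if `(A, B)` is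
closed for `f` (rows in `B`, offsets represented in `B`) then `π(ps) ⊕ π(0)` lies in the projection of `B`
for every `s ∈ A`: the frame directions `F g` with `g ⊥ W := Im B_π(ps,·)` lie in `rad B_s` with offset value
`g·(π(ps) ⊕ π 0)`, so the representing `ℓ ∈ B` has `ℓ_κ ⊕ π(ps) ⊕ π(0) ∈ W^⊥⊥ = W ⊆ proj B`.
[cite: Carlet2020, Prop. 54] -/
theorem frame_offset_mem {f : (Fin n → Bool) → Bool} {F : (Fin m → Bool) → (Fin n → Bool)}
    {p : (Fin n → Bool) → (Fin m → Bool)} {π : (Fin m → Bool) → (Fin m → Bool)} {κ : Fin m → Fin n}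
    (D : (Fin n → Bool) → (Fin n → Bool) → (Fin n → Bool) → Bool)
    (hD : ∀ u v x, D u v x = (f x ^^ f (bxor x u) ^^ f (bxor x v) ^^ f (bxor x (bxor u v))))
    (hπ : ∀ i, IsDegLeFun 2 fun y => π y i)
    (hF : ∀ X g, (f X ^^ f (bxor X (F g))) = (univ.filter fun i => g i && π (p X) i).card.bodd)
    (hp : ∀ X Y, p (bxor X Y) = bxor (p X) (p Y)) (hp0 : p zeroVec = zeroVec)
    (hκ : ∀ (g : Fin m → Bool) (u : Fin n → Bool),
      (univ.filter fun i => F g i && u i).card.bodd = (univ.filter fun i => g i && u (κ i)).card.bodd)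
    (hsurj : ∀ t, ∃ X, p X = t)
    (hunit : ∀ i, F (fun j => decide (j = i)) = fun j => decide (j = κ i))
    {A B : Finset (Fin n → Bool)} (hBadd : ∀ x ∈ B, ∀ y ∈ B, bxor x y ∈ B)
    (hrow : ∀ s ∈ A, ∀ y, (fun k => (D s y zeroVec ^^ D s y (fun j => decide (j = k)))) ∈ B)
    (hoff : ∀ s ∈ A, ∃ ℓ ∈ B, ∀ r, (∀ y z, (D s r z ^^ D s r (bxor z y)) = false) →
      (f r ^^ f (bxor r s) ^^ f zeroVec ^^ f s) = (univ.filter fun i => ℓ i && r i).card.bodd) :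
    ∀ s ∈ A, (fun i => (π (p s) i ^^ π zeroVec i)) ∈ B.image (fun u i => u (κ i)) := by
  intro s hs
  -- `W = Im B_π(ps, ·)`, a subspace of `𝔽₂^m` inside the projection of `B`
  set W : Finset (Fin m → Bool) :=
    univ.image fun t => fun i => (π (bxor (p s) t) i ^^ π (p s) i ^^ π t i ^^ π zeroVec i)
  have hW0 : zeroVec ∈ W := mem_image.2 ⟨zeroVec, mem_univ _, bv_zero_right π (p s)⟩
  have hWadd : ∀ x ∈ W, ∀ y ∈ W, bxor x y ∈ W := by
    intro x hx y hy
    obtain ⟨t, -, rfl⟩ := mem_image.1 hx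
    obtain ⟨t', -, rfl⟩ := mem_image.1 hy
    exact mem_image.2 ⟨bxor t t', mem_univ _, bv_bxor hπ (p s) t t'⟩
  have hWB : W ⊆ B.image (fun u i => u (κ i)) := fun x hx => by
    obtain ⟨t, -, rfl⟩ := mem_image.1 hx
    exact frame_row_mem D hD hπ hF hp hsurj hunit hrow s hs t
  obtain ⟨ℓ, hℓB, hℓ⟩ := hoff s hs
  -- the vector `π(ps) ⊕ π(0) ⊕ ℓ_κ` is orthogonal to `W^⊥`
  have key : bxor (fun i => (π (p s) i ^^ π zeroVec i)) (fun i => ℓ (κ i)) ∈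
      univ.filter (fun z => ∀ y ∈ (univ.filter fun y => ∀ x ∈ W, twist x y = 1), twist y z = 1) := by
    refine mem_filter.2 ⟨mem_univ _, fun g hg => ?_⟩
    have hgW : ∀ t, (univ.filter fun i => g i &&
        (π (bxor (p s) t) i ^^ π (p s) i ^^ π t i ^^ π zeroVec i)).card.bodd = false := fun t => by
      rw [bdot_comm]
      exact (twist_eq_one_iff_bdot _ _).1
        ((mem_filter.1 hg).2 _ (mem_image.2 ⟨t, mem_univ _, rfl⟩))
    have hval := hℓ (F g) (frame_inRad D hD hπ hF hp s g hgW)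
    rw [← D_zeroVec_eq D hD s (F g), frame_D2 D hD hF hp s zeroVec g, hp0, zeroVec_bxor,
      bdot_comm ℓ (F g), hκ] at hval
    rw [twist_eq_one_iff_bdot, bdot_bxor_right, bdot_xor_right, ← hval]
    generalize (univ.filter fun i => g i && π zeroVec i).card.bodd = P
    generalize (univ.filter fun i => g i && π (p s) i).card.bodd = Q
    revert P Q; decide
  rw [perp_perp_eq hW0 hWadd] at key
  have hℓ' : (fun i => ℓ (κ i)) ∈ B.image (fun u i => u (κ i)) := mem_image.2 ⟨ℓ, hℓB, rfl⟩
  have hmem := bxor_mem_image_proj hBadd _ (hWB key) _ hℓ'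
  have e : bxor (bxor (fun i => (π (p s) i ^^ π zeroVec i)) (fun i => ℓ (κ i))) (fun i => ℓ (κ i)) =
      fun i => (π (p s) i ^^ π zeroVec i) := by
    funext i
    show (((π (p s) i ^^ π zeroVec i) ^^ ℓ (κ i)) ^^ ℓ (κ i)) = (π (p s) i ^^ π zeroVec i)
    rw [Bool.xor_assoc, Bool.xor_self, Bool.xor_false]
  rw [e] at hmem
  exact hmem

end NoTrap

/-- **Closed + orthogonal ⇒ flat** (registered brick `noTrap_flatOfClosedOrth` of stub `stub_noTrapTemplate`, line
`dual-pingpong-frame`, crux stmt-QuantumAdvantage-13932; tree vocabulary = the line's `ClosedF f A B`, `Orth A B` unfolded):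
for `f` of degree `≤ 3`, if the slice rows `k ↦ D_{e_k} D_s D_y f (0)` (`s ∈ A`) lie in `B`, the offsets `r ↦ D_s D_r f (0)`
on `rad B_s` are represented in `B`, and `A ⊥ B`, then every second difference `D_s D_{s₂} f` (`s, s₂ ∈ A`) vanishes
identically. [cite: Carlet2020, §2.2.2] -/
theorem noTrap_flatOfClosedOrth : ∀ {n : ℕ} (f : (Fin n → Bool) → Bool) (A B : Finset (Fin n → Bool)), IsDegLeFun 3 f → (∀ s ∈ A, ∀ y : Fin n → Bool, (fun k => (f zeroVec ^^ f (bxor zeroVec s) ^^ f (bxor zeroVec y) ^^ f (bxor zeroVec (bxor s y))) ^^ (f (fun j => decide (j = k)) ^^ f (bxor (fun j => decide (j = k)) s) ^^ f (bxor (fun j => decide (j = k)) y) ^^ f (bxor (fun j => decide (j = k)) (bxor s y)))) ∈ B) → (∀ s ∈ A, ∃ ℓ ∈ B, ∀ r : Fin n → Bool, (∀ y z : Fin n → Bool, ((f z ^^ f (bxor z s) ^^ f (bxor z r) ^^ f (bxor z (bxor s r))) ^^ (f (bxor z y) ^^ f (bxor (bxor z y) s) ^^ f (bxor (bxor z y)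 r) ^^ f (bxor (bxor z y) (bxor s r)))) = false) → (f r ^^ f (bxor r s) ^^ f zeroVec ^^ f s) = ((Finset.univ.filter fun i => ℓ i && r i).card).bodd) → (∀ s ∈ A, ∀ u ∈ B, ((Finset.univ.filter fun i => s i && u i).card).bodd = false) → ∀ s ∈ A, ∀ s₂ ∈ A, ∀ x, (f x ^^ f (bxor x s) ^^ f (bxor x s₂) ^^ f (bxor x (bxor s s₂))) = false :=
  fun f _ _ hf hrow hoff horth =>
    NoTrap.flat_of_closed_orth hf (fun u v x => (f x ^^ f (bxor x u) ^^ f (bxor x v) ^^ f (bxor x (bxor u v))))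
      (fun _ _ _ => rfl) hrow hoff horth

end Summit.QuantumAdvantage.QuantumAdvantage.Theorems.SignedExactCubicForrelationNotPrBPP

end
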